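import Summits.Ventures.HodgeRepro2.AntidiagonalInvolution

/-!
# AntidiagonalReflectionFamily — a one-parameter family of NON-INTEGRAL unitary involutions of the
record's `U(antidiag(1,u,1))`, and the (N)-period statement over ALL involutions (p2 annex row 155)

Cell pub-hodge-repro2, Tier 5 kernel annex (seat p2, Shimura-data / Hecke side). Three definitions
(`tiltVector`, `tiltReflection`, `tiltReflectionGL`), the rest proof lane.
§8(d): uses an L-value-free non-vanishing device: NO.

For the record's hermitian form `H_u = antidiag(1, u, 1)` (`antidiagForm u`, `ρ u = u`, `u ≠ 0`) and a REAL
parameter `t ≠ 0` (`ρ t = t`), the vector `v_t = (t, 0, −1)` has `v_t* H_u v_t = −2t ≠ 0`, so row 150's unitary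
reflection `r_{v_t}` is defined, and it is the explicit matrix
`tiltReflection t = [[0,0,t],[0,1,0],[t⁻¹,0,0]] = diag(t,1,t⁻¹) · antidiag(1,1,1)`
(`reflection_antidiagForm_tiltVector`, `tiltReflection_eq_diagonal_mul`). Hence
`δ_t := −r_{v_t} ∈ SU(H_u)(K)` is an involution `≠ 1` (`neg_tiltReflectionGL_mem_specialUnitaryGroup`), and
for `t = 2` it does NOT stabilise the standard lattice `𝒪_K³` (`e₃ δ_2 = (−1/2, 0, 0)` and `1/2 ∉ 𝒪_K`,
`not_stabilizesLattice_neg_tiltReflectionGL_two`): `T_{δ_2}` on `S_k(Γ_N)` is a genuinely multi-coset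
self-adjoint Hecke operator (`δ_2² = 1 ⇒ δ_2⁻¹ ∈ S δ_2 S`, row 147's `inv_mem_doubleCoset_of_sq_mem`), in
contrast with the Atkin–Lehner involution of row 154 which is a single slash.
The closing statement `NonVanishingInput.exists_hecke_eigenform_hodgePeriod_ne_zero_of_mul_self_eq_one`
quantifies row 141's (N)-period theorem over ALL involutions `δ ∈ U(H)(K)`: each carries a holomorphic
weight-3 `T_δ`-eigenform `g` with REAL eigenvalue and `∫_D ω_f ∧ conj ω_g ≠ 0`.

No `sorry`; `#print axioms` ⊆ {propext, Classical.choice, Quot.sound}.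
-/

namespace Summit.Ventures.HodgeRepro2.ShimuraData

open Matrix

variable {K : Type*} [Field K] [NumberField K] [NumberField.IsCMField K]

/-- The tilt vector `v_t = (t, 0, −1) ∈ K³`. -/
def tiltVector (t : K) : Fin 3 → K := ![t, 0, -1]

omit [NumberField K] [NumberField.IsCMField K] in
/-- `H_u v_t = (−1, 0, t)`. -/
theorem antidiagForm_mulVec_tiltVector (u t : K) :
    (antidiagForm u).mulVec (tiltVector t) = ![-1, 0, t] := by
  ext i
  fin_cases i <;> simp [antidiagForm, tiltVector, Matrix.mulVec, dotProduct, Fin.sum_univ_three]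

/-- `v_t* H_u v_t = −2t` for real `t` (`ρ t = t`). -/
theorem hermDot_antidiagForm_tiltVector (u : K) {t : K} (ht : ρ K t = t) :
    hermDot (antidiagForm u) (tiltVector t) (tiltVector t) = -2 * t := by
  unfold hermDot
  rw [antidiagForm_mulVec_tiltVector]
  simp [tiltVector, dotProduct, Fin.sum_univ_three, ht]
  ring

/-- `v_t* H_u v_t ≠ 0` for real `t ≠ 0`. -/
theorem hermDot_antidiagForm_tiltVector_ne_zero (u : K) {t : K} (ht : ρ K t = t) (ht0 : t ≠ 0) :
    hermDot (antidiagForm u) (tiltVector t) (tiltVector t) ≠ 0 := by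
  rw [hermDot_antidiagForm_tiltVector u ht]
  exact mul_ne_zero (by norm_num) ht0

/-- `conjRow H_u v_t = v_t* H_u = (−1, 0, t)` for real `t`. -/
theorem conjRow_antidiagForm_tiltVector (u : K) {t : K} (ht : ρ K t = t) :
    conjRow (antidiagForm u) (tiltVector t) = ![-1, 0, t] := by
  ext i
  fin_cases i <;>
    simp [conjRow, antidiagForm, tiltVector, Matrix.vecMul, dotProduct, Fin.sum_univ_three, ht]

/-- The explicit matrix `[[0,0,t],[0,1,0],[t⁻¹,0,0]]` (the reflection `r_{v_t}` for real `t ≠ 0`). -/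
def tiltReflection (t : K) : Matrix (Fin 3) (Fin 3) K := !![0, 0, t; 0, 1, 0; t⁻¹, 0, 0]

omit [NumberField K] [NumberField.IsCMField K] in
/-- `tiltReflection t = diag(t, 1, t⁻¹) · antidiag(1, 1, 1)`. -/
theorem tiltReflection_eq_diagonal_mul (t : K) :
    tiltReflection t = Matrix.diagonal ![t, 1, t⁻¹] * antidiagForm 1 := by
  ext i j
  fin_cases i <;> fin_cases j <;>
    simp [tiltReflection, antidiagForm, Matrix.mul_apply, Matrix.diagonal]

/-- The unitary reflection of row 150 along `v_t` is the explicit matrix `tiltReflection t`. -/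
theorem reflection_antidiagForm_tiltVector (u : K) {t : K} (ht : ρ K t = t) (ht0 : t ≠ 0) :
    reflection (antidiagForm u) (tiltVector t) = tiltReflection t := by
  unfold reflection
  rw [hermDot_antidiagForm_tiltVector u ht, conjRow_antidiagForm_tiltVector u ht]
  ext i j
  fin_cases i <;> fin_cases j <;>
    simp [tiltReflection, tiltVector, Matrix.vecMulVec] <;>
    field_simp <;> ring

omit [NumberField K] [NumberField.IsCMField K] in
/-- `tiltReflection t` is an involution for `t ≠ 0`. -/
theorem tiltReflection_mul_self {t : K} (ht0 : t ≠ 0) :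
    tiltReflection t * tiltReflection t = 1 := by
  ext i j
  fin_cases i <;> fin_cases j <;>
    simp [tiltReflection, Matrix.mul_apply, Fin.sum_univ_three, ht0]

/-- `tiltReflection t` as an element of `GL₃(K)` (its own inverse). -/
def tiltReflectionGL (t : K) (ht0 : t ≠ 0) : GL (Fin 3) K :=
  ⟨tiltReflection t, tiltReflection t, tiltReflection_mul_self ht0, tiltReflection_mul_self ht0⟩

omit [NumberField K] [NumberField.IsCMField K] in
/-- The matrix of `tiltReflectionGL t` is `tiltReflection t`. -/
@[simp] theorem coe_tiltReflectionGL (t : K) (ht0 : t ≠ 0) :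
    (tiltReflectionGL t ht0 : Matrix (Fin 3) (Fin 3) K) = tiltReflection t := rfl

/-- `tiltReflectionGL t = reflectionGL H_u v_t` (row 150's unit) for real `t ≠ 0`. -/
theorem tiltReflectionGL_eq_reflectionGL (u : K) {t : K} (ht : ρ K t = t) (ht0 : t ≠ 0) :
    tiltReflectionGL t ht0 =
      reflectionGL (antidiagForm u) (tiltVector t) (hermDot_antidiagForm_tiltVector_ne_zero u ht ht0) := by
  apply Units.ext
  rw [coe_tiltReflectionGL, coe_reflectionGL, reflection_antidiagForm_tiltVector u ht ht0]

/-- `δ_t = −r_{v_t}` lies in `SU(H_u)(K)` for real `u ≠ 0` and real `t ≠ 0`. -/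
theorem neg_tiltReflectionGL_mem_specialUnitaryGroup {u : K} (hu : ρ K u = u) {t : K} (ht : ρ K t = t)
    (ht0 : t ≠ 0) : -tiltReflectionGL t ht0 ∈ specialUnitaryGroup K (antidiagForm u) := by
  rw [tiltReflectionGL_eq_reflectionGL u ht ht0]
  exact neg_reflectionGL_mem_specialUnitaryGroup (isHermitianForm_antidiagForm hu) _

omit [NumberField K] [NumberField.IsCMField K] in
/-- `δ_t` is an involution. -/
theorem neg_tiltReflectionGL_mul_self (t : K) (ht0 : t ≠ 0) :
    -tiltReflectionGL t ht0 * -tiltReflectionGL t ht0 = 1 := by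
  rw [neg_mul_neg]
  exact Units.ext (tiltReflection_mul_self ht0)

omit [NumberField.IsCMField K] in
/-- `δ_t ≠ 1`. -/
theorem neg_tiltReflectionGL_ne_one (t : K) (ht0 : t ≠ 0) : -tiltReflectionGL t ht0 ≠ 1 := by
  intro h
  have h2 : ((-tiltReflectionGL t ht0 : GL (Fin 3) K) : Matrix (Fin 3) (Fin 3) K) 1 1 = 1 := by
    rw [h]; simp
  simp [tiltReflection] at h2
  exact absurd h2 (by norm_num)

omit [NumberField.IsCMField K] in
/-- `1/2` is not an algebraic integer (`ℤ` is integrally closed in `ℚ`). -/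
theorem not_isIntegral_two_inv : ¬ IsIntegral ℤ ((2 : K)⁻¹) := by
  intro h
  have h' : IsIntegral ℤ ((2 : ℚ)⁻¹) := by
    have : ((2 : K)⁻¹) = algebraMap ℚ K ((2 : ℚ)⁻¹) := by simp
    rw [this] at h
    exact (isIntegral_algebraMap_iff (algebraMap ℚ K).injective).mp h
  obtain ⟨y, hy⟩ := IsIntegrallyClosed.isIntegral_iff.mp h'
  have hy' : (y : ℚ) * 2 = 1 := by
    rw [show algebraMap ℤ ℚ y = (y : ℚ) from rfl] at hy
    rw [hy]; norm_num
  have : (y * 2 : ℤ) = 1 := by exact_mod_cast hy'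
  omega

omit [NumberField K] [NumberField.IsCMField K] in
/-- The standard lattice `𝒪_K³` is a coordinate lattice (the hypothesis of row 154's
`stabilizesLattice_signInvolutionGL` / `hecke_signInvolution_antidiagForm`). -/
theorem standardLattice_coordinate :
    ∀ x ∈ standardLattice K 3, ∀ i : Fin 3, Pi.single i (x i) ∈ standardLattice K 3 := by
  intro x hx i
  rw [mem_standardLattice] at hx ⊢
  intro j
  by_cases hij : j = i
  · subst hij; simpa using hx j
  · simp [hij]; exact isIntegral_zero

omit [NumberField K] [NumberField.IsCMField K] in
/-- `e₃ ∈ 𝒪_K³`. -/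
theorem single_two_one_mem_standardLattice : (Pi.single 2 1 : Fin 3 → K) ∈ standardLattice K 3 := by
  rw [mem_standardLattice]
  intro j
  by_cases hj : j = 2
  · subst hj; simp; exact isIntegral_one
  · simp [hj]; exact isIntegral_zero

omit [NumberField.IsCMField K] in
/-- `δ_2 = −r_{v_2}` does NOT stabilise the standard lattice: `e₃ δ_2 = (−1/2, 0, 0)` and `1/2 ∉ 𝒪_K`.
Hence `T_{δ_2}` on `S_k(Γ_N)` (`Γ_N` the level-`N` group of `𝒪_K³`) is a genuinely multi-coset self-adjoint
Hecke operator, not a single slash. -/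
theorem not_stabilizesLattice_neg_tiltReflectionGL_two :
    ¬ StabilizesLattice (standardLattice K 3) (-tiltReflectionGL (2 : K) two_ne_zero) := by
  intro h
  have hx := h.1 (Pi.single 2 1) single_two_one_mem_standardLattice
  rw [mem_standardLattice] at hx
  have h0 := hx 0
  have : (Matrix.vecMul (Pi.single 2 1 : Fin 3 → K)
      ((-tiltReflectionGL (2 : K) two_ne_zero : GL (Fin 3) K) : Matrix (Fin 3) (Fin 3) K)) 0 =
      -((2 : K)⁻¹) := by
    simp [Matrix.vecMul, dotProduct, Fin.sum_univ_three, tiltReflection]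
  rw [this] at h0
  exact not_isIntegral_two_inv (by simpa using h0.neg)

/-- Row 141's (N)-period statement quantified over ALL involutions `δ ∈ U(H)(K)`: the Tier-3 input gives a
torsion-free congruence `S' ⊆ Γ_N` of finite index in `Γ₁` with compact quotient, a fundamental domain `D`,
a holomorphic weight-3 vertex form `f ≢ 0`, and for EVERY `δ ∈ U(H)(K)` with `δ² = 1` a holomorphic weight-3
form `g` for `S'` which is a `T_δ`-eigenform with REAL eigenvalue and `∫_D ω_f ∧ conj ω_g ≠ 0`
(`δ² = 1 ⇒ δ⁻¹ ∈ S'δS'` by row 147's `inv_mem_doubleCoset_of_sq_mem`). -/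
theorem NonVanishingInput.exists_hecke_eigenform_hodgePeriod_ne_zero_of_mul_self_eq_one
    {τ₁ : K →+* ℂ} {H : Matrix (Fin 3) (Fin 3) K} {Q : Matrix (Fin 3) (Fin 3) ℂ}
    {𝔪 : Submodule ℤ (Fin 3 → K)} (hH : IsHermitianForm K H)
    (hdef : ∀ τ : K →+* ℂ, NumberField.InfinitePlace.mk τ ≠ NumberField.InfinitePlace.mk τ₁ →
      IsDefiniteAt K τ H)
    (hQ : IsFrame K τ₁ H Q) (h𝔪 : IsLattice K 𝔪) (hnv : NonVanishingInput K τ₁ H 𝔪 Q)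
    {N : ℕ} (hN : 2 < N)
    [CompactSpace (ballQuotient hQ (shimuraLevelSubgroup K H 𝔪 1)
      (shimuraLevelSubgroup_one_subset_unitaryGroup H 𝔪))] :
    ∃ S' : Subgroup (GL (Fin 3) K), ∃ hS' : (S' : Set (GL (Fin 3) K)) ⊆ shimuraLevel K H 𝔪 N,
      IsTorsionFreeSet K (S' : Set (GL (Fin 3) K)) ∧
      ∃ (hS₁ : S' ≤ shimuraLevelSubgroup K H 𝔪 1)
        (hfin : (S'.subgroupOf (shimuraLevelSubgroup K H 𝔪 1)).FiniteIndex)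
        (_hc : CompactSpace (ballQuotient hQ S'
          (hS'.trans (shimuraLevelSubgroup_subset_unitaryGroup H 𝔪 N)))),
      ∃ D : Set ball₂, ∃ (hDm : MeasurableSet D)
        (hD : IsBallFundamentalDomain hQ S' (hS'.trans (shimuraLevelSubgroup_subset_unitaryGroup H 𝔪 N)) D),
      ∃ f ∈ holomorphicForms hQ S' (hS'.trans (shimuraLevelSubgroup_subset_unitaryGroup H 𝔪 N)) 3 hD,
        SeparationQuotient.mk f ≠ 0 ∧
        ∀ δ : unitaryGroup K H, (δ : GL (Fin 3) K) * δ = 1 →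
          ∃ g ∈ holomorphicForms hQ S' (hS'.trans (shimuraLevelSubgroup_subset_unitaryGroup H 𝔪 N)) 3 hD,
            (∃ r : ℝ, heckeFamilyOf hQ S' (hS'.trans (shimuraLevelSubgroup_subset_unitaryGroup H 𝔪 N)) 3 hD
                hDm (fun δ => fintypeHeckeQuotientOfFiniteIndex h𝔪 hS₁ hfin δ.2) δ
                (SeparationQuotient.mk g) = (r : ℂ) • SeparationQuotient.mk g) ∧
            ∫ x in (Subtype.val '' D),
              hodgeWedge
                (PeterssonForms.toForm hQ S' (hS'.trans (shimuraLevelSubgroup_subset_unitaryGroup H 𝔪 N))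
                  3 hD f : (Fin 2 → ℂ) → ℂ)
                (PeterssonForms.toForm hQ S' (hS'.trans (shimuraLevelSubgroup_subset_unitaryGroup H 𝔪 N))
                  3 hD g : (Fin 2 → ℂ) → ℂ) x ≠ 0 := by
  obtain ⟨S', hS', htf, hS₁, hfin, hc, D, hDm, hD, f, hf, hf0, hδ⟩ :=
    NonVanishingInput.exists_hecke_eigenform_hodgePeriod_ne_zero hH hdef hQ h𝔪 hnv hN
  refine ⟨S', hS', htf, hS₁, hfin, hc, D, hDm, hD, f, hf, hf0, fun δ hδ2 => ?_⟩
  exact hδ δ (inv_mem_doubleCoset_of_sq_mem (by rw [hδ2]; exact S'.one_mem))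

end Summit.Ventures.HodgeRepro2.ShimuraData
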